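import Mathlib.Analysis.ODE.ExistUnique
import Mathlib.Analysis.Calculus.Deriv.MeanValue
import HarnessLib

/-!
# Reflection-symmetric solutions of ODEs with odd right-hand side, and the one-variable
# estimates of Bray's collar construction

Topic `Literature/Analysis/ODE` (namespace `Literature.Analysis.ODE`). The reflection
`σ(t) = 2δ - t` of the time axis about `t = δ` transforms a solution `f` of `x' = v(t, x)` into a
solution `f ∘ σ` of `x' = -v(σ t, x)`; hence if the right-hand side is **odd about `t = δ`**,
`v(2δ - t, x) = -v(t, x)`, then `f ∘ σ` solves the same equation, agrees with `f` at the fixed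
point `t = δ`, and by uniqueness (Lipschitz right-hand side; Mathlib's
`ODE_solution_unique_of_mem_Icc`) `f(2δ - t) = f(t)`: **the solution is symmetric about
`t = δ`**. This is the principle behind the smoothness of Bray's reflection double
(J. Differential Geom. 59 (2001), §6, proof of Thm. 9, (95) ff.): the tangential metrics
`Ḡ_{ij}(z, t)` on the collar `Σ × [0, 2δ]` solve `d/dt Ḡ_{ij} = 2 Ḡ_{ik} h^k_j` with a second
fundamental form `h` extended *oddly* about `t = δ`, and *"by the oddness of `h^k_j(z,t)` about
`t = δ` it follows that `Ḡ_{ij}(z,t)` is symmetric about `t = δ`, that is,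
`Ḡ_{ij}(z,t) = Ḡ_{ij}(z,2δ-t)`. Hence, the identification of `Σ × (2δ)` with `Σ ∈` the second
copy of `(M³_Σ, g)` is smooth by symmetry."*

* `eqOn_reflection_of_odd` — the reflection principle for `x' = v(t, x)` on `[a, b]`,
  `a + b = 2δ`, `v(t, ·)` Lipschitz on a set `s` containing the trajectory and odd about `δ`;
  `eq_reflection_of_odd_of_lipschitzWith` — the globally Lipschitz form;
* `eq_reflection_of_hasDerivAt_odd` — the case of a right-hand side independent of `x`
  (`f' = k(t)` with `k` odd about `δ` ⇒ `f` even about `δ`; e.g. `Ḡ = Ḡ₀ + 2∫h` for the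
  lowered second fundamental form);
* `eq_reflection_of_mul_right_odd`, `eq_reflection_of_mul_left_odd` — the linear equations
  `X' = X B(t)` and `X' = B(t) X` in a normed ring with `B` bounded and odd about `δ` (Bray's (95)
  with `B = 2h`);
* `abs_le_mul_of_deriv_le_of_odd` — Bray's (99): if `H(0) = 0`, `H` is odd about `δ` and
  `Ḣ ≤ C` on `(0, 2δ)` (`C ≥ 0`), then `|H| ≤ C δ` on `[0, 2δ]` (mean value theorem on `[0, δ]`,
  where `H(0) = H(δ) = 0`, and reflection);
* `collar_scalarCurvature_lower_bound` — Bray's (100)–(101) as an inequality between real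
  numbers: `R = -2Ḣ + 2K - |h|² - H² ≥ R₀` with
  `R₀ = -2(2|α| + 1) + 2K₀ - (2β + 1) - (2|α| + 1)²`, independent of `δ ≤ 1`, under (97)–(99)
  and `K ≥ K₀`.

Everything is proved; no definitions and no named facts are introduced.

## References

* H. L. Bray, *Proof of the Riemannian Penrose inequality using the positive mass theorem*,
  J. Differential Geom. 59 (2001) 177–267 (arXiv:math/9911173), §6, proof of Thm. 9,
  (95)–(101). [BrayRPI2001]
* P. Hartman, *Ordinary Differential Equations*, 2nd ed., SIAM 2002, Ch. II, Thm. 1.1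
  (uniqueness for Lipschitz right-hand sides). [Hartman2002]
-/

noncomputable section

open Set Metric Filter
open scoped NNReal Topology

namespace Literature.Analysis.ODE

variable {E : Type*} [NormedAddCommGroup E] [NormedSpace ℝ E]

/-! ### The reflection principle -/

/-- **Reflection principle for ODEs with odd right-hand side.** Let `f` solve `x' = v(t, x)` on
`[a, b]` (continuous on `[a, b]`, `HasDerivAt` on `(a, b)`), where `a + b = 2δ`, `a < b`, the
trajectory stays in a set `s` on which every `v(t, ·)` is `K`-Lipschitz, and `v` is odd about
`t = δ` on `s`: `v(2δ - t, x) = -v(t, x)`. Then `f(2δ - t) = f(t)` on `[a, b]`: the reflected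
curve `t ↦ f(2δ - t)` solves the same equation (chain rule and oddness) with the same value at
`t = δ`, so the two agree by uniqueness (Hartman, Ch. II, Thm. 1.1; Mathlib's
`ODE_solution_unique_of_mem_Icc`). [folklore] -/
theorem eqOn_reflection_of_odd {v : ℝ → E → E} {s : Set E} {K : ℝ≥0} {f : ℝ → E}
    {a b δ : ℝ} (hab : a + b = 2 * δ) (hlt : a < b)
    (hv : ∀ t ∈ Ioo a b, LipschitzOnWith K (v t) s)
    (hodd : ∀ t ∈ Ioo a b, ∀ x ∈ s, v (2 * δ - t) x = -v t x)
    (hf : ContinuousOn f (Icc a b)) (hf' : ∀ t ∈ Ioo a b, HasDerivAt f (v t (f t)) t)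
    (hfs : ∀ t ∈ Ioo a b, f t ∈ s) :
    EqOn (fun t ↦ f (2 * δ - t)) f (Icc a b) := by
  have hδ : δ ∈ Ioo a b := ⟨by linarith, by linarith⟩
  have hmapIcc : MapsTo (fun t : ℝ ↦ 2 * δ - t) (Icc a b) (Icc a b) := fun t ht ↦
    ⟨by linarith [ht.2], by linarith [ht.1]⟩
  have hmapIoo : ∀ t ∈ Ioo a b, 2 * δ - t ∈ Ioo a b := fun t ht ↦
    ⟨by linarith [ht.2], by linarith [ht.1]⟩
  have hg : ContinuousOn (fun t ↦ f (2 * δ - t)) (Icc a b) :=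
    hf.comp (continuousOn_const.sub continuousOn_id) hmapIcc
  have hg' : ∀ t ∈ Ioo a b,
      HasDerivAt (fun t ↦ f (2 * δ - t)) (v t (f (2 * δ - t))) t := by
    intro t ht
    have h1 : HasDerivAt f (v (2 * δ - t) (f (2 * δ - t))) (2 * δ - t) := hf' _ (hmapIoo t ht)
    have h2 : HasDerivAt (fun t : ℝ ↦ 2 * δ - t) (-1) t := by
      simpa using (hasDerivAt_id t).const_sub (2 * δ)
    have h3 := h1.scomp t h2
    have h4 : (-1 : ℝ) • v (2 * δ - t) (f (2 * δ - t)) = v t (f (2 * δ - t)) := by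
      rw [hodd t ht _ (hfs _ (hmapIoo t ht)), neg_one_smul, neg_neg]
    rw [h4] at h3
    exact h3
  have hgs : ∀ t ∈ Ioo a b, f (2 * δ - t) ∈ s := fun t ht ↦ hfs _ (hmapIoo t ht)
  have heq : f (2 * δ - δ) = f δ := by rw [two_mul, add_sub_cancel_right]
  exact ODE_solution_unique_of_mem_Icc (s := fun _ ↦ s) hv hδ hg hg' hgs hf hf' hfs heq

/-- **Reflection principle, globally Lipschitz right-hand side**: if every `v(t, ·)` is
`K`-Lipschitz and `v(2δ - t, x) = -v(t, x)` for `t ∈ (a, b)`, `a + b = 2δ`, then every solution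
on `[a, b]` satisfies `f(2δ - t) = f(t)` there. [folklore] -/
theorem eq_reflection_of_odd_of_lipschitzWith {v : ℝ → E → E} {K : ℝ≥0} {f : ℝ → E}
    {a b δ : ℝ} (hab : a + b = 2 * δ) (hlt : a < b)
    (hv : ∀ t ∈ Ioo a b, LipschitzWith K (v t))
    (hodd : ∀ t ∈ Ioo a b, ∀ x, v (2 * δ - t) x = -v t x)
    (hf : ContinuousOn f (Icc a b)) (hf' : ∀ t ∈ Ioo a b, HasDerivAt f (v t (f t)) t)
    {t : ℝ} (ht : t ∈ Icc a b) : f (2 * δ - t) = f t :=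
  eqOn_reflection_of_odd (s := univ) hab hlt (fun t ht ↦ (hv t ht).lipschitzOnWith)
    (fun t ht x _ ↦ hodd t ht x) hf hf' (fun _ _ ↦ mem_univ _) ht

/-- **Primitives of odd functions are even** (the `x`-independent case): if `f' = k(t)` on
`(a, b)` with `k(2δ - t) = -k(t)`, `a + b = 2δ`, and `f` is continuous on `[a, b]`, then
`f(2δ - t) = f(t)` on `[a, b]`. (E.g. `Ḡ(t) = Ḡ(0) + 2∫₀ᵗ h` for a second fundamental form `h`
extended oddly about `δ`, Bray 2001, (95).) [folklore] -/
theorem eq_reflection_of_hasDerivAt_odd {k : ℝ → E} {f : ℝ → E} {a b δ : ℝ}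
    (hab : a + b = 2 * δ) (hlt : a < b) (hodd : ∀ t ∈ Ioo a b, k (2 * δ - t) = -k t)
    (hf : ContinuousOn f (Icc a b)) (hf' : ∀ t ∈ Ioo a b, HasDerivAt f (k t) t)
    {t : ℝ} (ht : t ∈ Icc a b) : f (2 * δ - t) = f t :=
  eq_reflection_of_odd_of_lipschitzWith (v := fun t _ ↦ k t) (K := 0) hab hlt
    (fun _ _ ↦ LipschitzWith.const' _) (fun t ht _ ↦ hodd t ht) hf hf' ht

/-! ### Linear equations in a normed ring (Bray's (95)) -/

section Ring

variable {A : Type*} [NormedRing A] [NormedAlgebra ℝ A]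

omit [NormedAlgebra ℝ A] in
/-- Right multiplication by an element of norm `≤ M` is `M`-Lipschitz. [folklore] -/
theorem lipschitzWith_mul_right {B : A} {M : ℝ≥0} (hB : ‖B‖ ≤ M) :
    LipschitzWith M fun X : A ↦ X * B := by
  refine LipschitzWith.of_dist_le_mul fun X Y ↦ ?_
  rw [dist_eq_norm, dist_eq_norm, ← sub_mul]
  calc ‖(X - Y) * B‖ ≤ ‖X - Y‖ * ‖B‖ := norm_mul_le _ _
    _ ≤ ‖X - Y‖ * M := by gcongr
    _ = M * ‖X - Y‖ := mul_comm _ _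

omit [NormedAlgebra ℝ A] in
/-- Left multiplication by an element of norm `≤ M` is `M`-Lipschitz. [folklore] -/
theorem lipschitzWith_mul_left {B : A} {M : ℝ≥0} (hB : ‖B‖ ≤ M) :
    LipschitzWith M fun X : A ↦ B * X := by
  refine LipschitzWith.of_dist_le_mul fun X Y ↦ ?_
  rw [dist_eq_norm, dist_eq_norm, ← mul_sub]
  calc ‖B * (X - Y)‖ ≤ ‖B‖ * ‖X - Y‖ := norm_mul_le _ _
    _ ≤ M * ‖X - Y‖ := by gcongr

/-- **Bray's symmetry of the collar metric, (95) ff.**: a solution `X` of the linear equation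
`X' = X B(t)` on `[a, b]` (`a + b = 2δ`) with bounded coefficient `B` which is odd about `δ`,
`B(2δ - t) = -B(t)`, is symmetric about `δ`: `X(2δ - t) = X(t)`. With `A` the `2 × 2` matrices,
`X = Ḡ` and `B = 2h` this is *"by the oddness of `h^k_j(z,t)` about `t = δ` it follows that
`Ḡ_{ij}(z,t)` is symmetric about `t = δ`"* (Bray 2001, proof of Thm. 9).
[cite: BrayRPI2001, §6 proof of Thm. 9, (95)] -/
theorem eq_reflection_of_mul_right_odd {B : ℝ → A} {X : ℝ → A} {a b δ : ℝ} {M : ℝ≥0}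
    (hab : a + b = 2 * δ) (hlt : a < b) (hB : ∀ t ∈ Ioo a b, ‖B t‖ ≤ M)
    (hodd : ∀ t ∈ Ioo a b, B (2 * δ - t) = -B t)
    (hX : ContinuousOn X (Icc a b)) (hX' : ∀ t ∈ Ioo a b, HasDerivAt X (X t * B t) t)
    {t : ℝ} (ht : t ∈ Icc a b) : X (2 * δ - t) = X t :=
  eq_reflection_of_odd_of_lipschitzWith (v := fun t Y ↦ Y * B t) hab hlt
    (fun t ht ↦ lipschitzWith_mul_right (hB t ht)) (fun t ht Y ↦ by rw [hodd t ht, mul_neg])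
    hX hX' ht

/-- The same for `X' = B(t) X`. [cite: BrayRPI2001, §6 proof of Thm. 9, (95)] -/
theorem eq_reflection_of_mul_left_odd {B : ℝ → A} {X : ℝ → A} {a b δ : ℝ} {M : ℝ≥0}
    (hab : a + b = 2 * δ) (hlt : a < b) (hB : ∀ t ∈ Ioo a b, ‖B t‖ ≤ M)
    (hodd : ∀ t ∈ Ioo a b, B (2 * δ - t) = -B t)
    (hX : ContinuousOn X (Icc a b)) (hX' : ∀ t ∈ Ioo a b, HasDerivAt X (B t * X t) t)
    {t : ℝ} (ht : t ∈ Icc a b) : X (2 * δ - t) = X t :=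
  eq_reflection_of_odd_of_lipschitzWith (v := fun t Y ↦ B t * Y) hab hlt
    (fun t ht ↦ lipschitzWith_mul_left (hB t ht)) (fun t ht Y ↦ by rw [hodd t ht, neg_mul])
    hX hX' ht

end Ring

/-! ### Bray's one-variable estimates (99)–(101) -/

/-- **Bray's (99).** If `H(0) = 0`, `H` is odd about `δ` on `[0, 2δ]` (`H(2δ - t) = -H(t)`, so
that also `H(δ) = H(2δ) = 0`), `H` is continuous on `[0, 2δ]`, differentiable on `(0, 2δ)` with
`Ḣ ≤ C` there (`C ≥ 0`), then `|H(t)| ≤ C δ` on `[0, 2δ]` (mean value theorem on `[0, δ]`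
between the zeros `0` and `δ`, and reflection for `t ≥ δ`). In Bray's collar `C = 2|α| + 1`
((97)) and `H(z, 0) = 0 = H(z, 2δ)` because `Σ` is a horizon ((96)).
[cite: BrayRPI2001, §6 proof of Thm. 9, (96)–(99)] -/
theorem abs_le_mul_of_deriv_le_of_odd {H : ℝ → ℝ} {C δ : ℝ} (hδ : 0 ≤ δ) (hC : 0 ≤ C)
    (hcont : ContinuousOn H (Icc 0 (2 * δ))) (hdiff : DifferentiableOn ℝ H (Ioo 0 (2 * δ)))
    (hderiv : ∀ t ∈ Ioo 0 (2 * δ), deriv H t ≤ C) (h0 : H 0 = 0)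
    (hodd : ∀ t ∈ Icc 0 (2 * δ), H (2 * δ - t) = -H t) {t : ℝ} (ht : t ∈ Icc 0 (2 * δ)) :
    |H t| ≤ C * δ := by
  have hδmem : δ ∈ Icc 0 (2 * δ) := ⟨hδ, by linarith⟩
  have hHδ : H δ = 0 := by
    have h := hodd δ hδmem
    rw [show 2 * δ - δ = δ by ring] at h
    linarith
  have hint : interior (Icc 0 (2 * δ)) = Ioo 0 (2 * δ) := interior_Icc
  have hmvt : ∀ x ∈ Icc 0 (2 * δ), ∀ y ∈ Icc 0 (2 * δ), x ≤ y → H y - H x ≤ C * (y - x) :=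
    fun x hx y hy hxy ↦ (convex_Icc 0 (2 * δ)).image_sub_le_mul_sub_of_deriv_le hcont
      (hint ▸ hdiff) (fun t ht ↦ hderiv t (hint ▸ ht)) x hx y hy hxy
  -- the estimate on `[0, δ]`
  have key : ∀ u ∈ Icc 0 δ, |H u| ≤ C * δ := by
    intro u hu
    have hu' : u ∈ Icc 0 (2 * δ) := ⟨hu.1, by linarith [hu.2]⟩
    have h1 := hmvt 0 ⟨le_rfl, by linarith⟩ u hu' hu.1
    have h2 := hmvt u hu' δ hδmem hu.2
    rw [h0] at h1
    rw [hHδ] at h2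
    rw [abs_le]
    constructor <;> nlinarith [hu.1, hu.2]
  rcases le_total t δ with htδ | hδt
  · exact key t ⟨ht.1, htδ⟩
  · have h := hodd (2 * δ - t) ⟨by linarith [ht.2], by linarith [ht.1]⟩
    rw [show 2 * δ - (2 * δ - t) = t by ring] at h
    have : |H t| = |H (2 * δ - t)| := by rw [h, abs_neg]
    rw [this]
    exact key (2 * δ - t) ⟨by linarith [ht.2], by linarith⟩

/-- **Bray's (100)–(101) as arithmetic.** With `R = -2Ḣ + 2K - |h|² - H²` (second variation
and Gauss equation on the collar, (100)), the bounds `Ḣ ≤ 2|α| + 1` ((97)),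
`|h|² ≤ 2β + 1` ((98)), `|H| ≤ (2|α| + 1) δ` ((99)), a lower bound `K ≥ K₀` for the Gauss
curvature and `δ ≤ 1` give `R ≥ R₀` with
`R₀ = -2(2|α| + 1) + 2K₀ - (2β + 1) - (2|α| + 1)²` independent of `δ` ((101)).
[cite: BrayRPI2001, §6 proof of Thm. 9, (97)–(101)] -/
theorem collar_scalarCurvature_lower_bound {Hdot K hsq H α β K₀ δ : ℝ}
    (h97 : Hdot ≤ 2 * |α| + 1) (h98 : hsq ≤ 2 * β + 1) (h99 : |H| ≤ (2 * |α| + 1) * δ)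
    (hK : K₀ ≤ K) (hδ₁ : δ ≤ 1) :
    -2 * (2 * |α| + 1) + 2 * K₀ - (2 * β + 1) - (2 * |α| + 1) ^ 2 ≤
      -2 * Hdot + 2 * K - hsq - H ^ 2 := by
  have hα : 0 ≤ 2 * |α| + 1 := by positivity
  have hH : |H| ≤ 2 * |α| + 1 := h99.trans (by nlinarith)
  have hH2 : H ^ 2 ≤ (2 * |α| + 1) ^ 2 := by
    rw [← sq_abs H]
    exact pow_le_pow_left₀ (abs_nonneg H) hH 2
  linarith

end Literature.Analysis.ODE

end
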